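import Summits.AnomalousDissipation.AnomalousDissipation.Theorems.MomentParityQuarticGateModeCalculus
import Summits.AnomalousDissipation.AnomalousDissipation.Theorems.MomentParityQuarticGateAtomRows

/-!
# Mode pairs with complex polarisation: symmetry, transversality, sums, zero self-stress

Helper file for stub S5 (`stub_balancedMenu`) of the line `farkas-split-menu` of crux
`MomentParity.CubicParityLoud` (stmt-AnomalousDissipation-11465). Every piece of the balanced menu
is built from MODE PAIRS `δ_k w + δ_{-k} w̄` (`Pi.single k w + Pi.single (-k) (conjVec w)`) with an
arbitrary complex amplitude `w ∈ ℂ³` (helical sea modes need genuinely complex `w`; the sibling file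
`…QuarticGateModeCalculus` treats the linearly polarised case `w = a • v`, `v` real). Recorded here:
conjugate symmetry, transversality (`k · w = 0`), the vanishing of the convection symbol of a
transversal pair against itself (a single Fourier mode is a steady Euler flow), sums over a
frequency set of functions of a pair (energy `2‖w‖²`, enstrophy weight `2|k|²‖w‖²`, pairings),
and the explicit HELICAL PAIR `k = (K,0,0)`, `w = A (0,1,±i)`: energy `4A²`, enstrophy weight
`4K²A²`, helicity weight `∓32π³K³A²`.
-/

namespace Summit.AnomalousDissipation.AnomalousDissipation.Theorems.MomentParityCubicParityLoud

open Finset Complex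
open scoped ComplexConjugate
open Literature.Analysis.FunctionSpaces Literature.Analysis.FluidPDE
open Summit.AnomalousDissipation.AnomalousDissipation.Theorems.MomentParityQuarticGate

set_option linter.dupNamespace false

section Pair

/-- Values of the mode pair `δ_k w + δ_{-k} w̄`. [folklore] -/
theorem pair_apply (k κ : Fin 3 → ℤ) (w : EuclideanSpace ℂ (Fin 3)) :
    (Pi.single k w + Pi.single (-k) (EuclideanSpace.conjVec w) : (Fin 3 → ℤ) → EuclideanSpace ℂ (Fin 3)) κ =
      (if κ = k then w else 0) + (if κ = -k then EuclideanSpace.conjVec w else 0) := by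
  simp only [Pi.add_apply, Pi.single_apply]

/-- **Conjugate symmetry of a mode pair** `δ_k w + δ_{-k} w̄`. [folklore] -/
theorem isConjSymm_pair (k : Fin 3 → ℤ) (w : EuclideanSpace ℂ (Fin 3)) :
    Torus.IsConjSymm (Pi.single k w + Pi.single (-k) (EuclideanSpace.conjVec w) :
      (Fin 3 → ℤ) → EuclideanSpace ℂ (Fin 3)) := by
  intro κ
  rw [pair_apply, pair_apply, EuclideanSpace.conjVec_add]
  simp only [neg_eq_iff_eq_neg, neg_neg, apply_ite EuclideanSpace.conjVec, EuclideanSpace.conjVec_conjVec,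
    EuclideanSpace.conjVec_zero]
  rw [add_comm]

/-- **Transversality of a mode pair** with `k · w = 0`. [folklore] -/
theorem isTransversal_pair (S : Finset (Fin 3 → ℤ)) {k : Fin 3 → ℤ} {w : EuclideanSpace ℂ (Fin 3)}
    (hkw : ∑ j, (k j : ℂ) * w j = 0) :
    Torus.IsTransversal S (Pi.single k w + Pi.single (-k) (EuclideanSpace.conjVec w) :
      (Fin 3 → ℤ) → EuclideanSpace ℂ (Fin 3)) := by
  intro κ _
  have hconj : ∑ j, ((-k) j : ℂ) * EuclideanSpace.conjVec w j = 0 := by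
    have := congrArg (starRingEnd ℂ) hkw
    rw [map_sum, map_zero] at this
    rw [← neg_eq_zero, ← this, ← Finset.sum_neg_distrib]
    refine Finset.sum_congr rfl fun j _ => ?_
    simp [EuclideanSpace.conjVec_apply]
  rw [pair_apply]
  by_cases h1 : κ = k
  · subst h1
    by_cases h2 : κ = -κ
    · simp only [if_true, PiLp.add_apply, mul_add, Finset.sum_add_distrib, hkw, zero_add]
      rw [if_pos h2]
      have : ∑ j, (κ j : ℂ) * EuclideanSpace.conjVec w j = ∑ j, ((-κ) j : ℂ) * EuclideanSpace.conjVec w j := by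
        rw [← h2]
      rw [this, hconj]
    · simp only [if_true, if_neg h2, add_zero, hkw]
  · by_cases h2 : κ = -k
    · subst h2
      simp only [if_neg h1, if_true, zero_add, hconj]
    · simp [if_neg h1, if_neg h2]

/-- **A transversal mode pair has zero convection symbol against itself** (a single real Fourier
mode is a steady Euler flow): `convectionCoeff S P P = 0` for `P = δ_k w + δ_{-k} w̄`, `k · w = 0`.
[folklore] -/
theorem convectionCoeff_pair_self (S : Finset (Fin 3 → ℤ)) {k : Fin 3 → ℤ} {w : EuclideanSpace ℂ (Fin 3)}
    (hkw : ∑ j, (k j : ℂ) * w j = 0) :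
    Torus.convectionCoeff S (Pi.single k w + Pi.single (-k) (EuclideanSpace.conjVec w))
      (Pi.single k w + Pi.single (-k) (EuclideanSpace.conjVec w)) = 0 := by
  have h1 : ∑ j, w j * (k j : ℂ) = 0 := by
    rw [← hkw]; exact Finset.sum_congr rfl fun j _ => mul_comm _ _
  have h2 : ∑ j, w j * ((-k) j : ℂ) = 0 := by
    simp only [Pi.neg_apply, Int.cast_neg, mul_neg, Finset.sum_neg_distrib, h1, neg_zero]
  have h3 : ∑ j, EuclideanSpace.conjVec w j * (k j : ℂ) = 0 := by
    have := congrArg (starRingEnd ℂ) h1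
    rw [map_sum, map_zero] at this
    rw [← this]
    refine Finset.sum_congr rfl fun j _ => ?_
    simp [EuclideanSpace.conjVec_apply]
  have h4 : ∑ j, EuclideanSpace.conjVec w j * ((-k) j : ℂ) = 0 := by
    simp only [Pi.neg_apply, Int.cast_neg, mul_neg, Finset.sum_neg_distrib, h3, neg_zero]
  funext κ
  rw [Torus.convectionCoeff_add_left, Torus.convectionCoeff_add_right, Torus.convectionCoeff_add_right,
    convectionCoeff_single_single_eq_zero S k h1, convectionCoeff_single_single_eq_zero S k h2,
    convectionCoeff_single_single_eq_zero S (-k) h3, convectionCoeff_single_single_eq_zero S (-k) h4]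
  simp

/-- **Sums over a frequency set of a function of a mode pair** have two terms:
`∑_{κ∈S} F κ (P κ) = F k w + F (-k) w̄` (`k ≠ 0`, `±k ∈ S`, `F κ 0 = 0`). [folklore] -/
theorem sum_apply_pair {M : Type*} [AddCommMonoid M] {S : Finset (Fin 3 → ℤ)} {k : Fin 3 → ℤ}
    (hk0 : k ≠ 0) (hk : k ∈ S) (hnk : -k ∈ S) (F : (Fin 3 → ℤ) → EuclideanSpace ℂ (Fin 3) → M)
    (hF : ∀ κ, F κ 0 = 0) (w : EuclideanSpace ℂ (Fin 3)) :
    ∑ κ ∈ S, F κ ((Pi.single k w + Pi.single (-k) (EuclideanSpace.conjVec w) :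
      (Fin 3 → ℤ) → EuclideanSpace ℂ (Fin 3)) κ) = F k w + F (-k) (EuclideanSpace.conjVec w) :=
  sum_apply_single_add_single (self_ne_neg.mpr hk0) hk hnk F hF w _

/-- **Energy of a mode pair**: `∑_{κ∈S} ‖P κ‖² = 2‖w‖²`. [folklore] -/
theorem sum_norm_sq_pair {S : Finset (Fin 3 → ℤ)} {k : Fin 3 → ℤ} (hk0 : k ≠ 0) (hk : k ∈ S) (hnk : -k ∈ S)
    (w : EuclideanSpace ℂ (Fin 3)) :
    ∑ κ ∈ S, ‖(Pi.single k w + Pi.single (-k) (EuclideanSpace.conjVec w) :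
      (Fin 3 → ℤ) → EuclideanSpace ℂ (Fin 3)) κ‖ ^ 2 = 2 * ‖w‖ ^ 2 := by
  rw [sum_apply_pair hk0 hk hnk (fun _ z => ‖z‖ ^ 2) (fun _ => by simp) w, EuclideanSpace.norm_conjVec]
  ring

/-- **Enstrophy weight of a mode pair**: `∑_{κ∈S} |κ|² ‖P κ‖² = 2|k|²‖w‖²`. [folklore] -/
theorem sum_freqNormSq_mul_norm_sq_pair {S : Finset (Fin 3 → ℤ)} {k : Fin 3 → ℤ} (hk0 : k ≠ 0) (hk : k ∈ S)
    (hnk : -k ∈ S) (w : EuclideanSpace ℂ (Fin 3)) :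
    ∑ κ ∈ S, Torus.freqNormSq κ * ‖(Pi.single k w + Pi.single (-k) (EuclideanSpace.conjVec w) :
      (Fin 3 → ℤ) → EuclideanSpace ℂ (Fin 3)) κ‖ ^ 2 = 2 * (Torus.freqNormSq k * ‖w‖ ^ 2) := by
  rw [sum_apply_pair hk0 hk hnk (fun κ z => Torus.freqNormSq κ * ‖z‖ ^ 2) (fun _ => by simp) w,
    EuclideanSpace.norm_conjVec, Torus.freqNormSq_neg]
  ring

/-- **Pairing of a mode pair with a conjugate-symmetric family**: `∑_{κ∈S} Re⟪g κ, P κ⟫ = 2 Re⟪g k, w⟫`.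
[folklore] -/
theorem sum_re_inner_pair {S : Finset (Fin 3 → ℤ)} {k : Fin 3 → ℤ} (hk0 : k ≠ 0) (hk : k ∈ S) (hnk : -k ∈ S)
    {g : (Fin 3 → ℤ) → EuclideanSpace ℂ (Fin 3)} (hg : Torus.IsConjSymm g) (w : EuclideanSpace ℂ (Fin 3)) :
    ∑ κ ∈ S, (inner ℂ (g κ) ((Pi.single k w + Pi.single (-k) (EuclideanSpace.conjVec w) :
      (Fin 3 → ℤ) → EuclideanSpace ℂ (Fin 3)) κ)).re = 2 * (inner ℂ (g k) w).re := by
  rw [sum_apply_pair hk0 hk hnk (fun κ z => (inner ℂ (g κ) z).re) (fun _ => by simp) w, hg k]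
  have : inner ℂ (EuclideanSpace.conjVec (g k)) (EuclideanSpace.conjVec w) = conj (inner ℂ (g k) w) := by
    simp only [PiLp.inner_apply, EuclideanSpace.conjVec_apply, map_sum]
    refine Finset.sum_congr rfl fun j _ => ?_
    simp [RCLike.inner_apply, mul_comm]
  rw [this, Complex.conj_re]
  ring

/-- The squared norm as a real inner product: `Re⟪w, w⟫ = ‖w‖²`. [folklore] -/
theorem re_inner_self (w : EuclideanSpace ℂ (Fin 3)) : (inner ℂ w w).re = ‖w‖ ^ 2 := by
  have := inner_self_eq_norm_sq (𝕜 := ℂ) w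
  rwa [RCLike.re_to_complex] at this

end Pair

/-! ## The helical pair on the Taylor shell -/

section Helical

/-- The shell frequency `(K, 0, 0)` has squared norm `K²`. [folklore] -/
theorem freqNormSq_shell (K : ℕ) : Torus.freqNormSq (![(K : ℤ), 0, 0] : Fin 3 → ℤ) = (K : ℝ) ^ 2 := by
  simp [Torus.freqNormSq, Fin.sum_univ_three]

/-- The shell frequency is non-zero for `K ≥ 1`. [folklore] -/
theorem shell_ne_zero {K : ℕ} (hK : 1 ≤ K) : (![(K : ℤ), 0, 0] : Fin 3 → ℤ) ≠ 0 := by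
  intro h
  have := congrFun h 0
  simp at this
  omega

/-- The shell frequency lies in the punctured ball of radius `N ≥ K`. [folklore] -/
theorem shell_mem {K N : ℕ} (hK : 1 ≤ K) (hKN : K ≤ N) :
    (![(K : ℤ), 0, 0] : Fin 3 → ℤ) ∈ (Torus.freqBall N).erase 0 := by
  refine Finset.mem_erase.2 ⟨shell_ne_zero hK, Torus.mem_freqBall.2 ?_⟩
  rw [freqNormSq_shell]
  exact_mod_cast Nat.pow_le_pow_left hKN 2

/-- The opposite shell frequency lies in the punctured ball of radius `N ≥ K`. [folklore] -/
theorem neg_shell_mem {K N : ℕ} (hK : 1 ≤ K) (hKN : K ≤ N) :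
    -(![(K : ℤ), 0, 0] : Fin 3 → ℤ) ∈ (Torus.freqBall N).erase 0 :=
  neg_mem_freqBall_erase_zero _ (shell_mem hK hKN)

/-- The helical amplitudes `A (0, 1, ±i)` are transversal to the shell frequency. [folklore] -/
theorem shell_transversal (K : ℕ) (A σ : ℂ) :
    ∑ j, (((![(K : ℤ), 0, 0] : Fin 3 → ℤ) j : ℤ) : ℂ) * (A • !₂[(0 : ℂ), 1, σ]) j = 0 := by
  simp [Fin.sum_univ_three]

/-- Norm of the helical amplitude: `‖A (0, 1, ±i)‖² = 2A²` for `σ = ±i`. [folklore] -/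
theorem norm_sq_helical (A : ℝ) {σ : ℂ} (hσ : ‖σ‖ = 1) :
    ‖((A : ℂ) • !₂[(0 : ℂ), 1, σ] : EuclideanSpace ℂ (Fin 3))‖ ^ 2 = 2 * A ^ 2 := by
  rw [norm_smul, mul_pow, Complex.norm_real, Real.norm_eq_abs, sq_abs, EuclideanSpace.norm_sq_eq]
  simp [Fin.sum_univ_three, hσ]
  ring

/-- **Curl pairings of a mode pair**: `∑_{κ∈S} Re⟪P κ, c κ • curlCoeff P κ⟫` has the two terms at
`±k` (the curl symbol is diagonal). [folklore] -/
theorem sum_re_inner_smul_curlCoeff_pair {S : Finset (Fin 3 → ℤ)} {k : Fin 3 → ℤ} (hk0 : k ≠ 0) (hk : k ∈ S)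
    (hnk : -k ∈ S) (c : (Fin 3 → ℤ) → ℂ) (w : EuclideanSpace ℂ (Fin 3)) :
    ∑ κ ∈ S, (inner ℂ ((Pi.single k w + Pi.single (-k) (EuclideanSpace.conjVec w) :
        (Fin 3 → ℤ) → EuclideanSpace ℂ (Fin 3)) κ)
      (c κ • IntermittentBeltrami.curlCoeff (Pi.single k w + Pi.single (-k) (EuclideanSpace.conjVec w) :
        (Fin 3 → ℤ) → EuclideanSpace ℂ (Fin 3)) κ)).re =
      (inner ℂ w (c k • IntermittentBeltrami.curlCoeff (fun _ => w) k)).re +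
        (inner ℂ (EuclideanSpace.conjVec w)
          (c (-k) • IntermittentBeltrami.curlCoeff (fun _ => EuclideanSpace.conjVec w) (-k))).re :=
  sum_apply_pair hk0 hk hnk
    (fun κ' z => (inner ℂ z (c κ' • IntermittentBeltrami.curlCoeff (fun _ => z) κ')).re)
    (fun κ => by simp only [inner_zero_left, Complex.zero_re]) w

/-- **Pairings of the curl of a mode pair with a family**: `∑_{κ∈S} Re⟪g κ, curlCoeff P κ⟫` has the
two terms at `±k`. [folklore] -/
theorem sum_re_inner_curlCoeff_pair {S : Finset (Fin 3 → ℤ)} {k : Fin 3 → ℤ} (hk0 : k ≠ 0) (hk : k ∈ S)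
    (hnk : -k ∈ S) (g : (Fin 3 → ℤ) → EuclideanSpace ℂ (Fin 3)) (w : EuclideanSpace ℂ (Fin 3)) :
    ∑ κ ∈ S, (inner ℂ (g κ) (IntermittentBeltrami.curlCoeff (Pi.single k w + Pi.single (-k) (EuclideanSpace.conjVec w) :
        (Fin 3 → ℤ) → EuclideanSpace ℂ (Fin 3)) κ)).re =
      (inner ℂ (g k) (IntermittentBeltrami.curlCoeff (fun _ => w) k)).re +
        (inner ℂ (g (-k)) (IntermittentBeltrami.curlCoeff (fun _ => EuclideanSpace.conjVec w) (-k))).re :=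
  sum_apply_pair hk0 hk hnk
    (fun κ' z => (inner ℂ (g κ') (IntermittentBeltrami.curlCoeff (fun _ => z) κ')).re)
    (fun κ => by rw [curlCoeff_apply_eq_zero rfl, inner_zero_right, Complex.zero_re]) w

/-- **Helicity weight of the helical pair**: for `k = (K,0,0)`, `w = A (0, 1, σ i)` (`σ` real;
`σ = ±1` are the two helical polarisations, `k × w = ∓ i K w` then),
`∑_{κ∈S} Re⟪P κ, -(4π²|κ|²) • curlCoeff P κ⟫ = -σ · 32π³K³A²`. [folklore] -/
theorem helicity_helical_pair {S : Finset (Fin 3 → ℤ)} {K : ℕ} (hK : 1 ≤ K)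
    (hk : (![(K : ℤ), 0, 0] : Fin 3 → ℤ) ∈ S) (hnk : -(![(K : ℤ), 0, 0] : Fin 3 → ℤ) ∈ S)
    (A σ : ℝ) :
    ∑ κ ∈ S, (inner ℂ ((Pi.single (![(K : ℤ), 0, 0] : Fin 3 → ℤ) ((A : ℂ) • !₂[(0 : ℂ), 1, σ * I]) +
        Pi.single (-(![(K : ℤ), 0, 0] : Fin 3 → ℤ)) (EuclideanSpace.conjVec ((A : ℂ) • !₂[(0 : ℂ), 1, σ * I])) :
          (Fin 3 → ℤ) → EuclideanSpace ℂ (Fin 3)) κ)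
      (-(((4 * Real.pi ^ 2 * Torus.freqNormSq κ : ℝ) : ℂ)) •
        IntermittentBeltrami.curlCoeff (Pi.single (![(K : ℤ), 0, 0] : Fin 3 → ℤ) ((A : ℂ) • !₂[(0 : ℂ), 1, σ * I]) +
          Pi.single (-(![(K : ℤ), 0, 0] : Fin 3 → ℤ)) (EuclideanSpace.conjVec ((A : ℂ) • !₂[(0 : ℂ), 1, σ * I])) :
            (Fin 3 → ℤ) → EuclideanSpace ℂ (Fin 3)) κ)).re =
      -σ * (32 * Real.pi ^ 3 * (K : ℝ) ^ 3 * A ^ 2) := by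
  rw [sum_re_inner_smul_curlCoeff_pair (shell_ne_zero hK) hk hnk
      (fun κ => -(((4 * Real.pi ^ 2 * Torus.freqNormSq κ : ℝ) : ℂ))),
    Torus.freqNormSq_neg, freqNormSq_shell]
  simp only [PiLp.inner_apply, RCLike.inner_apply, Fin.sum_univ_three, PiLp.smul_apply, smul_eq_mul,
    IntermittentBeltrami.curlCoeff_apply, EuclideanSpace.conjVec_apply, cross_apply]
  simp only [Matrix.cons_val_zero, Matrix.cons_val_one, Matrix.head_cons, Matrix.cons_val_two, Matrix.tail_cons,
    Pi.neg_apply, map_mul, Complex.conj_ofReal,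
    map_zero, Complex.conj_I, Int.cast_zero, Int.cast_natCast, Int.cast_neg, neg_zero, mul_zero,
    zero_mul, mul_one, sub_zero, zero_sub, zero_add]
  simp only [Complex.add_re, Complex.mul_re, Complex.mul_im, Complex.neg_re, Complex.neg_im, Complex.ofReal_re,
    Complex.ofReal_im, Complex.I_re, Complex.I_im, Complex.conj_re, Complex.conj_im,
    Complex.re_ofNat, Complex.im_ofNat, Complex.natCast_re, Complex.natCast_im]
  ring

end Helical

/-- **Registered sub-goal `balancedMenu_pairSelfStress` of stub S5 `stub_balancedMenu`** (summary of
this file): a transversal mode pair `δ_k w + δ_{-k} w̄` has zero convection symbol against itself (a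
single Fourier mode is a steady Euler flow). [folklore] -/
theorem balancedMenu_pairSelfStress : ∀ (S : Finset (Fin 3 → ℤ)) (k : Fin 3 → ℤ) (w : EuclideanSpace ℂ (Fin 3)), ∑ j, (k j : ℂ) * w j = 0 → Torus.convectionCoeff S (Pi.single k w + Pi.single (-k) (EuclideanSpace.conjVec w)) (Pi.single k w + Pi.single (-k) (EuclideanSpace.conjVec w)) = 0 :=
  fun S _ _ hkw => convectionCoeff_pair_self S hkw

end Summit.AnomalousDissipation.AnomalousDissipation.Theorems.MomentParityCubicParityLoud
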